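import Literature.Geometry.Riemannian.KernelGradientIntegralBound
import HarnessLib

/-!
# Differentiating the semigroup formula of the heat kernel in the base point
# (Bamler 2020a, §7, display (7.26))

R. Bamler, *Entropy and heat kernel bounds on a Ricci flow background*, arXiv:2008.07093 (2020a),
proof of Thm. 7.5 (the pointwise gradient bound for the heat kernel), display (7.26):
differentiate the semigroup (reproduction) formula

  `K(x,t;y,s) = ∫_M K(x,t;z,r) K(z,r;y,s) dg_r(z)`,   `a < s < r < t`,

in the base point `x`: `∇ₓ K(x,t;y,s) = ∫_M ∇ₓ K(x,t;z,r) K(z,r;y,s) dg_r(z)`. For the tree's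
kernel function `K = hflow.heatKernelFn hh hR` (`RicciFlowHeatKernelFn.lean`) of a Ricci flow `hflow`
on `[a, T]` of a `C^∞` family of Riemannian metrics on a closed connected manifold `M`, the
base-point derivative is rendered as the derivative along a `C^∞` curve `γ : ℝ → M` of base points:

* `hasDerivAt_integral_mul_heatKernelFn_curve` — dominated differentiation under the integral
  sign with a continuous weight `w`: for `a < r < t < T`,
  `d/dσ ∫ w(z) K(γ σ,t;z,r) dg_r(z) = ∫ w(z) ∂_σ K(γ σ,t;z,r) dg_r(z)`;
* `deriv_heatKernelFn_curve_eq_integral_mul` — (7.26) along `γ`: for `a < s < r < t < T`,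
  `∂_σ K(γ σ,t;y,s) = ∫ ∂_σ K(γ σ,t;z,r) K(z,r;y,s) dg_r(z)`;
* auxiliary: `IsRicciFlow.exists_norm_deriv_heatKernelFn_curve_le` — `∂_σ K(γ σ,t;y,s)` is
  bounded uniformly in `y ∈ M` and `σ ∈ (σ₀ − 1, σ₀ + 1)` (Lipschitz bound of `K(·,t;y,s)` for
  `d_{g_t}`, `heatKernelFn_lipschitz_basePoint`, and of `γ` on compact parameter intervals,
  `exists_edist_le_mul_sub_of_contMDiff`).

Everything is proved (tool: `hasDerivAt_integral_of_dominated_loc_of_deriv_le`); no definitions.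
What is NOT here: the identification of `∂_σ K` with `⟨∇ₓ K, γ̇⟩`, higher derivatives, `t = T`.

## References

* R. H. Bamler, *Entropy and heat kernel bounds on a Ricci flow background*, arXiv:2008.07093
  (2020), §2.3 (semigroup property), §7, proof of Thm. 7.5, display (7.26). [Bamler2020Entropy]
-/

noncomputable section

open Set Filter Function MeasureTheory Measure
open scoped Manifold ContDiff Topology ENNReal NNReal

namespace Literature.Geometry.Riemannian

open Lorentzian Lorentzian.PseudoRiemannianMetric

section Kernel

variable {m : ℕ} {H : Type*} [TopologicalSpace H]
  {I : ModelWithCorners ℝ (EuclideanSpace ℝ (Fin m)) H} [I.Boundaryless]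
  {M : Type*} [TopologicalSpace M] [ChartedSpace H M] [IsManifold I ∞ M]
  [T2Space M] [CompactSpace M] [SecondCountableTopology M] [MeasurableSpace M] [BorelSpace M]
  [PreconnectedSpace M]
  {h : ℝ → PseudoRiemannianMetric I ∞ (EuclideanSpace ℝ (Fin m)) (TangentSpace I : M → Type _)}
  {cov : ℝ → CovariantDerivative I (EuclideanSpace ℝ (Fin m)) (TangentSpace I : M → Type _)}
  {a T : ℝ} (hflow : IsRicciFlow h cov (Icc a T)) (hh : IsContMDiffFamilyOn ∞ h univ)
  (hR : ∀ r, (h r).IsRiemannian)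

/-- **`∂_σ K(γ σ,t;y,s)` is bounded, uniformly in `y ∈ M` and `σ ∈ (σ₀ − 1, σ₀ + 1)`**, for
`a < s < t < T` and a `C^∞` curve `γ` of base points: `K(·,t;y,s)` is `L`-Lipschitz for `d_{g_t}`
uniformly in `y` (`heatKernelFn_lipschitz_basePoint`) and `d_{g_t}(γ σ, γ σ') ≤ C |σ' − σ|` on
`[σ₀ − 2, σ₀ + 2]` (`exists_edist_le_mul_sub_of_contMDiff`), whence `|∂_σ K| ≤ max(L,0) C`.
[folklore] -/
theorem IsRicciFlow.exists_norm_deriv_heatKernelFn_curve_le {s t : ℝ} (has : a < s)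
    (hst : s < t) (htT : t < T) {γ : ℝ → M} (hγ : ContMDiff 𝓘(ℝ, ℝ) I ∞ γ) (σ₀ : ℝ) :
    ∃ B : ℝ, ∀ y, ∀ σ ∈ Ioo (σ₀ - 1) (σ₀ + 1),
      ‖deriv (fun σ ↦ hflow.heatKernelFn hh hR t (γ σ) (y, s)) σ‖ ≤ B := by
  have ht : t ∈ Ioc a T := ⟨has.trans hst, htT.le⟩
  have h1le : (1 : ℕ∞ω) ≤ (∞ : ℕ∞ω) := by exact_mod_cast le_top
  -- the Lipschitz bound in the base point and the Lipschitz bound of `γ` for `d_{g_t}`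
  obtain ⟨L, hL⟩ := hflow.heatKernelFn_lipschitz_basePoint hh hR ht (a' := (a + s) / 2)
    (b' := (s + t) / 2) (by linarith) (by linarith) (by linarith)
  obtain ⟨C, hC0, hC⟩ := exists_edist_le_mul_sub_of_contMDiff (h t) (hR t) (hγ.of_le h1le)
    (σ₀ - 2) (σ₀ + 2)
  have hsI : s ∈ Icc ((a + s) / 2) ((s + t) / 2) := ⟨by linarith, by linarith⟩
  have hlip : ∀ y, ∀ σ ∈ Icc (σ₀ - 2) (σ₀ + 2), ∀ σ' ∈ Icc (σ₀ - 2) (σ₀ + 2),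
      |hflow.heatKernelFn hh hR t (γ σ') (y, s) - hflow.heatKernelFn hh hR t (γ σ) (y, s)| ≤
        max L 0 * C * |σ' - σ| := by
    intro y σ hσ σ' hσ'
    wlog hle : σ ≤ σ' generalizing σ σ' with H'
    · have h' := H' σ' hσ' σ hσ (le_of_not_ge hle)
      rwa [abs_sub_comm, abs_sub_comm σ σ'] at h'
    have h1 := hL (γ σ') (γ σ) (y, s) ⟨mem_univ _, hsI⟩
    have h2 : (h t).edist (hR t) (γ σ') (γ σ) ≤ ENNReal.ofReal (C * (σ' - σ)) := by
      rw [PseudoRiemannianMetric.edist_comm]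
      exact hC hσ.1 hle hσ'.2
    have h0 : 0 ≤ max L 0 * (C * (σ' - σ)) :=
      mul_nonneg (le_max_right _ _) (mul_nonneg hC0 (sub_nonneg.2 hle))
    have h3 : ENNReal.ofReal
        |hflow.heatKernelFn hh hR t (γ σ') (y, s) - hflow.heatKernelFn hh hR t (γ σ) (y, s)| ≤
        ENNReal.ofReal (max L 0 * (C * (σ' - σ))) :=
      calc _ ≤ ENNReal.ofReal L * (h t).edist (hR t) (γ σ') (γ σ) := h1
        _ ≤ ENNReal.ofReal (max L 0) * ENNReal.ofReal (C * (σ' - σ)) :=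
          mul_le_mul' (ENNReal.ofReal_le_ofReal (le_max_left _ _)) h2
        _ = ENNReal.ofReal (max L 0 * (C * (σ' - σ))) :=
          (ENNReal.ofReal_mul (le_max_right _ _)).symm
    rw [abs_of_nonneg (sub_nonneg.2 hle), mul_assoc]
    exact (ENNReal.ofReal_le_ofReal_iff h0).1 h3
  refine ⟨max L 0 * C, fun y σ hσ ↦ ?_⟩
  refine norm_deriv_le_of_lip' (mul_nonneg (le_max_right _ _) hC0) ?_
  filter_upwards [Icc_mem_nhds (by linarith [hσ.1] : σ₀ - 2 < σ)
    (by linarith [hσ.2] : σ < σ₀ + 2)] with σ' hσ'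
  rw [Real.norm_eq_abs, Real.norm_eq_abs]
  exact hlip y σ ⟨by linarith [hσ.1], by linarith [hσ.2]⟩ σ' hσ'

/-- **Differentiating `∫ w(z) K(γ(σ),t;z,r) dg_r(z)` along a curve of base points** (the
dominated-differentiation step behind Bamler 2020a, (7.26)). For a Ricci flow on `[a, T]` of a
`C^∞` family of Riemannian metrics on a closed connected manifold, `a < r < t < T`, a `C^∞` curve
`γ : ℝ → M` and a continuous weight `w : M → ℝ`:
`d/dσ|_{σ₀} ∫ w(z) K(γ σ,t;z,r) dg_r(z) = ∫ w(z) ∂_σ|_{σ₀} K(γ σ,t;z,r) dg_r(z)`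
(`w` is bounded on the compact `M`, `σ ↦ K(γ σ,t;z,r)` is `C^∞`, `(z, σ) ↦ K(γ σ,t;z,r)` is
continuous, so `∂_σ K` is measurable in `z`, and `∂_σ K` is bounded uniformly in `z`, locally
in `σ`, by `IsRicciFlow.exists_norm_deriv_heatKernelFn_curve_le`).
[cite: Bamler2020Entropy, §7, proof of Thm. 7.5, (7.26)] -/
theorem hasDerivAt_integral_mul_heatKernelFn_curve {r t : ℝ} (har : a < r) (hrt : r < t)
    (htT : t < T) {γ : ℝ → M} (hγ : ContMDiff 𝓘(ℝ, ℝ) I ∞ γ) {w : M → ℝ} (hw : Continuous w)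
    (σ₀ : ℝ) :
    HasDerivAt (fun σ ↦ ∫ z, w z * hflow.heatKernelFn hh hR t (γ σ) (z, r) ∂(h r).riemVolume)
      (∫ z, w z * deriv (fun σ ↦ hflow.heatKernelFn hh hR t (γ σ) (z, r)) σ₀ ∂(h r).riemVolume)
      σ₀ := by
  have ht : t ∈ Ioc a T := ⟨har.trans hrt, htT.le⟩
  have hr : r ∈ Ioo a t := ⟨har, hrt⟩
  have hrT : r ∈ Ioo a T := ⟨har, hrt.trans htT⟩
  haveI : IsFiniteMeasure (h r).riemVolume := ⟨(h r).riemVolume_univ_lt_top⟩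
  -- slices, joint continuity and derivatives of `(σ, z) ↦ K(γ σ, t; z, r)`
  have hKs : ∀ σ, Continuous fun z ↦ hflow.heatKernelFn hh hR t (γ σ) (z, r) := fun σ ↦
    hflow.continuous_heatKernelFn_slice hh hR ht (γ σ) hr
  have hKc : Continuous fun p : M × ℝ ↦ hflow.heatKernelFn hh hR t (γ p.2) (p.1, r) := by
    have hι : Continuous fun p : M × ℝ ↦ (((γ p.2, t) : M × ℝ), p.1) :=
      ((hγ.continuous.comp continuous_snd).prodMk continuous_const).prodMk continuous_fst
    exact (hflow.continuousOn_heatKernelFn_basePoint hh hR hrT).comp_continuous hι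
      fun p ↦ ⟨⟨mem_univ _, hrt, htT.le⟩, mem_univ _⟩
  have hKD : ∀ z σ, HasDerivAt (fun σ ↦ hflow.heatKernelFn hh hR t (γ σ) (z, r))
      (deriv (fun σ ↦ hflow.heatKernelFn hh hR t (γ σ) (z, r)) σ) σ := fun z σ ↦
    hflow.hasDerivAt_heatKernelFn_curve hh hR har hrt htT hγ z σ
  -- measurability of `z ↦ ∂_σ|_{σ₀} K(γ σ, t; z, r)`
  have hm : Measurable fun z ↦ deriv (fun σ ↦ hflow.heatKernelFn hh hR t (γ σ) (z, r)) σ₀ :=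
    (measurable_deriv_with_param
      (f := fun (z : M) (σ : ℝ) ↦ hflow.heatKernelFn hh hR t (γ σ) (z, r)) hKc).comp
      (measurable_id.prodMk measurable_const)
  -- bounds for `w` and for `∂_σ K`
  obtain ⟨W, hW⟩ := isCompact_univ.exists_bound_of_continuousOn hw.continuousOn
  obtain ⟨B, hB⟩ := hflow.exists_norm_deriv_heatKernelFn_curve_le hh hR har hrt htT hγ σ₀
  refine (hasDerivAt_integral_of_dominated_loc_of_deriv_le (μ := (h r).riemVolume)
    (F := fun σ z ↦ w z * hflow.heatKernelFn hh hR t (γ σ) (z, r))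
    (F' := fun σ z ↦ w z * deriv (fun σ ↦ hflow.heatKernelFn hh hR t (γ σ) (z, r)) σ)
    (x₀ := σ₀) (s := Ioo (σ₀ - 1) (σ₀ + 1)) (bound := fun _ ↦ W * B)
    (Ioo_mem_nhds (by linarith) (by linarith)) ?_ ?_ ?_ ?_ (integrable_const _) ?_).2
  · exact Eventually.of_forall fun σ ↦ (hw.mul (hKs σ)).aestronglyMeasurable
  · exact (hw.mul (hKs σ₀)).integrable_of_hasCompactSupport (HasCompactSupport.of_compactSpace _)
  · exact (hw.measurable.mul hm).aestronglyMeasurable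
  · refine Eventually.of_forall fun z σ hσ ↦ ?_
    rw [norm_mul]
    have h1 : ‖w z‖ ≤ W := hW z (mem_univ _)
    exact mul_le_mul h1 (hB z σ hσ) (norm_nonneg _) ((norm_nonneg _).trans h1)
  · exact Eventually.of_forall fun z σ _ ↦ (hKD z σ).const_mul (w z)

/-- **Bamler 2020a, (7.26), along a curve of base points**: for a Ricci flow on `[a, T]` of a
`C^∞` family of Riemannian metrics on a closed connected manifold, `a < s < r < t < T`, a `C^∞`
curve `γ : ℝ → M`, `y ∈ M` and `σ₀ ∈ ℝ`,
`∂_σ|_{σ₀} K(γ σ,t;y,s) = ∫ ∂_σ|_{σ₀} K(γ σ,t;z,r) · K(z,r;y,s) dg_r(z)`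
(differentiate the semigroup formula `K(γ σ,t;y,s) = ∫ K(γ σ,t;z,r) K(z,r;y,s) dg_r(z)`,
`heatKernelFn_semigroup`, under the integral sign, `hasDerivAt_integral_mul_heatKernelFn_curve`
with the continuous weight `z ↦ K(z,r;y,s)`).
[cite: Bamler2020Entropy, §7, proof of Thm. 7.5, (7.26)] -/
theorem deriv_heatKernelFn_curve_eq_integral_mul {s r t : ℝ} (has : a < s) (hsr : s < r)
    (hrt : r < t) (htT : t < T) {γ : ℝ → M} (hγ : ContMDiff 𝓘(ℝ, ℝ) I ∞ γ) (y : M) (σ₀ : ℝ) :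
    deriv (fun σ ↦ hflow.heatKernelFn hh hR t (γ σ) (y, s)) σ₀ =
      ∫ z, deriv (fun σ ↦ hflow.heatKernelFn hh hR t (γ σ) (z, r)) σ₀ *
        hflow.heatKernelFn hh hR r z (y, s) ∂(h r).riemVolume := by
  have har : a < r := has.trans hsr
  have hs : s ∈ Ioo a r := ⟨has, hsr⟩
  have hsT : s ∈ Ioo a T := ⟨has, hsr.trans (hrt.trans htT)⟩
  -- the weight `z ↦ K(z,r;y,s)` is continuous
  have hw : Continuous fun z ↦ hflow.heatKernelFn hh hR r z (y, s) := by
    have hι : Continuous fun z : M ↦ (((z, r) : M × ℝ), y) :=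
      (continuous_id.prodMk continuous_const).prodMk continuous_const
    exact (hflow.continuousOn_heatKernelFn_basePoint hh hR hsT).comp_continuous hι
      fun z ↦ ⟨⟨mem_univ _, hsr, (hrt.trans htT).le⟩, mem_univ _⟩
  have hD := hasDerivAt_integral_mul_heatKernelFn_curve hflow hh hR har hrt htT hγ hw σ₀
  -- the semigroup identity, as functions of `σ`
  have heq : (fun σ ↦ hflow.heatKernelFn hh hR t (γ σ) (y, s)) = fun σ ↦
      ∫ z, hflow.heatKernelFn hh hR r z (y, s) * hflow.heatKernelFn hh hR t (γ σ) (z, r)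
        ∂(h r).riemVolume := by
    funext σ
    rw [hflow.heatKernelFn_semigroup hh hR har hrt htT.le (γ σ) hs y]
    exact integral_congr_ae (Eventually.of_forall fun z ↦ mul_comm _ _)
  rw [heq, hD.deriv]
  exact integral_congr_ae (Eventually.of_forall fun z ↦ mul_comm _ _)

end Kernel

end Literature.Geometry.Riemannian

end
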